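import Literature.NumberTheory.Li1992.RallisLocalFactorEulerBoundsAssembly
import Literature.NumberTheory.Li1992.RallisLocalFactorAllPlaces
import HarnessLib

/-!
# [Li1992, Thm 2.1 (27)] — a factorizable test vector whose Euler product of local factors CONVERGES and has NON-ZERO factors

J.-S. Li, J. reine angew. Math. **428** (1992), Thm 2.1 p. 184 and §5 p. 206: the right-hand side of Rallis' inner product formula for
factorizable data is the absolutely convergent Euler product (27) `∏_v I_v(Φ_v)`; «for almost all `v`» the factor is the unramified one
(spherical vector `1_{𝒪_vᴺ}`), and at the finitely many remaining places a test vector makes `I_v ≠ 0` (Thm 5.4, Cor. 5.5).  THIS FILE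
assembles, for the rank-one member `U(J₁)` of the pair `(U(J), U(J₁))` (`dim J = N ≥ 3`) in the tree's currency
(`ω_v = 𝓢.omegaLoc v ∘ localCenter`, `χ_{1,v} = localCharOfCenter χ₁ v`, local pairing on `𝒮(F_vᴺ)` against `μ'_vᴺ` NORMALISED by
`μ'_vᴺ(𝒪_vᴺ)⁻¹`, local Haar measures `ν^W_v` with `ν^W_v(U(J₁)(𝒪_v)) = 1` off `S₀`), ONE FAMILY `Φ = (Φ_v)_v` with `Φ_v = 1_{𝒪_vᴺ}` off a finite
`T ⊇ T₀ ∪ S₀` and, for the local factors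
  `fl_v(g) = (μ'_vᴺ(𝒪_vᴺ)⁻¹ • ⟨ω_v(g·1) Φ_v, Φ_v⟩_{μ'_vᴺ}) · conj χ_{1,v}(g)`,
the FOUR ROWS consumed by the restricted-product exchange [TateThesis1967, Thm 3.3.1] and the non-vanishing of the product
(the cell's Theorems file `H413FinCoeffNonvanishing.integral_finCoeff_ne_zero_of_localFactors`, rows `hfl hB hsum hne`):

* **`exists_testVector_integrable_localFactor_ne_zero_of_three_le`** — at EVERY finite place a test vector `Φ_v` whose local integrand is
  `dh`-INTEGRABLE and has `I_v(Φ_v) ≠ 0` (★ `RallisLocalFactorAllPlaces` kept only `≠ 0`; at a non-split place the `χ_{1,v}`-eigenvector's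
  integrand is constant on the compact torus);
* **`exists_family_localFactor_rows`** — `∃ T ⊇ T₀, ∃ Φ`, `Φ_v = 1_{𝒪_vᴺ}` off `T`, and for `fl` as displayed: every `fl_v` integrable, ONE bound
  for all finite partial products `∏_{v∈S} ∫ |fl_v|`, `Σ_v |∫ fl_v − 1| < ∞`, and `∫ fl_v ≠ 0` for every `v` — from ★
  `eventually_localFactor_unitVec_normalised_bounds` (`|I_v − 1| ≤ 12 N(v)^{-N/2}`, `∫|fl_v| ≤ 1 + 4 N(v)^{-N/2}` off a finite set), ★
  `eventually_localFactor_unitVec_ne_zero`, ★ `Li1992.summable_absNorm_rpow_neg_half_of_three_le` and the abstract bookkeeping ★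
  `Li1992.exists_prod_le_of_eventually_le_one_add` ∕ `Li1992.summable_norm_sub_one_of_eventually_le`.

KERNEL only: theorems, no definition, no named fact, no `sorry`.  Cell hodgecm-mathlib, FLOOR 0, programme P4 (F3′ capstone), crux item
H413 (`--supports stmt-HodgeConjecture-24833`).  HC_CM is proved only modulo the printed citations until rung 0 closes; nothing here is a
claim about them.

## References
* [Li1992] J.-S. Li, J. reine angew. Math. 428 (1992) 177–217 — Thm 2.1 (27) p. 184; §5 Thm 5.4, Cor. 5.5 p. 206.
* [TateThesis1967] J. Tate, in Cassels–Fröhlich, *Algebraic Number Theory* (1967), Ch. XV Thm 3.3.1.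
* [MoeglinVignerasWaldspurger1987] C. Mœglin, M.-F. Vignéras, J.-L. Waldspurger, LNM 1291 (1987), Chap. 3 §IV.2 Lemme.
-/

set_option autoImplicit false

noncomputable section

open NumberField IsDedekindDomain MeasureTheory Filter Set
open scoped Matrix NNReal Topology ComplexConjugate
open Literature.RepresentationTheory Literature.RepresentationTheory.HeisenbergGroup
open Literature.NumberTheory.Automorphic
open Literature.NumberTheory.Automorphic.UnitaryGroup
open Literature.NumberTheory.Automorphic.Liu2021
open Literature.NumberTheory.GaloisRepresentations.IsNonarchimedeanLocalField

namespace Literature.NumberTheory.GelbartRogawski1991.UnitaryDualPair.LocalSplitting.FinLocalSplittings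

variable {F : Type} [Field F] [NumberField F] {E : Type} [Field E] [NumberField E] [Algebra F E]
  [Algebra.IsQuadraticExtension F E] {c : E ≃ₐ[F] E} {N : ℕ} {δ : E} {hcδ : c δ = -δ} {hδ : δ ≠ 0} {d : F}
  {hd : δ * δ = algebraMap F E d} {T : Matrix (Fin N) (Fin N) F} {hT : T.IsSymm}
  {J : Matrix (Fin N) (Fin N) E} {hJ : J = T.map (algebraMap F E)}
  (𝓢 : FinLocalSplittings F E c N hcδ hδ hd T hT hJ) (J₁ : Matrix (Fin 1) (Fin 1) E) (hJ₁ : J₁ 0 0 ≠ 0)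
  (hTd : IsUnit T.det)

include hTd in
/-- **At every finite place a test vector with INTEGRABLE local integrand and non-zero local factor** (`N ≥ 3`, `χ₁` continuous unitary,
`dh` finite on compacts charging open sets): split `v` — ★ `exists_testVector_localFactor_ne_zero_of_split_localCharOfCenter`; non-split `v` —
the `χ_{1,v}`-eigenvector of ★ `Li1992.exists_localFactor_ne_zero_of_nonsplit_of_three_le` ([MVW, Chap. 3 IV.2]), whose integrand is the
constant `⟨Φ, Φ⟩` on the compact torus. [cite: Li1992, Thm 2.1 (27) p. 184; Thm 5.4 a) p. 206]
[cite: MoeglinVignerasWaldspurger1987, Chap. 3 §IV.2 Lemme (p. 76)] -/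
theorem exists_testVector_integrable_localFactor_ne_zero_of_three_le (h3 : 3 ≤ N) (hJ₁c : (J₁.map c)ᵀ = J₁)
    (v : HeightOneSpectrum (𝓞 F)) {χ₁ : finAdelicOne F E c →* ℂˣ} (hχ₁ : Continuous χ₁) (hχ₁u : ∀ x, ‖((χ₁ x : ℂˣ) : ℂ)‖ = 1)
    [MeasurableSpace (localPi E c 1 J₁ v)] [BorelSpace (localPi E c 1 J₁ v)] (dh : Measure (localPi E c 1 J₁ v))
    [IsFiniteMeasureOnCompacts dh] [dh.IsOpenPosMeasure]
    [MeasurableSpace (v.adicCompletion F)] [BorelSpace (v.adicCompletion F)] (μ' : Measure (v.adicCompletion F)) [μ'.IsAddHaarMeasure] :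
    ∃ Φ : SchwartzBruhat (Fin N → v.adicCompletion F),
      Integrable (fun h : localPi E c 1 J₁ v => (∫ x, ((𝓢.omegaLoc v (localCenter E c N J J₁ hJ₁ v h) Φ :
            SchwartzBruhat (Fin N → v.adicCompletion F)) : (Fin N → v.adicCompletion F) → ℂ) x *
          conj (((Φ : SchwartzBruhat (Fin N → v.adicCompletion F)) : (Fin N → v.adicCompletion F) → ℂ) x)
          ∂(Measure.pi fun _ : Fin N => μ')) * conj ((localCharOfCenter F E c J₁ hJ₁ χ₁ v h : ℂˣ) : ℂ)) dh ∧
      (∫ h, (∫ x, ((𝓢.omegaLoc v (localCenter E c N J J₁ hJ₁ v h) Φ :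
            SchwartzBruhat (Fin N → v.adicCompletion F)) : (Fin N → v.adicCompletion F) → ℂ) x *
          conj (((Φ : SchwartzBruhat (Fin N → v.adicCompletion F)) : (Fin N → v.adicCompletion F) → ℂ) x)
          ∂(Measure.pi fun _ : Fin N => μ')) * conj ((localCharOfCenter F E c J₁ hJ₁ χ₁ v h : ℂˣ) : ℂ) ∂dh) ≠ 0 := by
  haveI : NeZero N := ⟨by omega⟩
  have hc : c ≠ 1 := by
    rintro rfl
    exact hδ (self_eq_neg.1 (by simpa only [AlgEquiv.one_apply] using hcδ))
  obtain ⟨w⟩ := (inferInstance : Nonempty (PlacesOver E v))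
  by_cases hw : c • w.1 = w.1
  · -- non-split `v`: a `χ_{1,v}`-eigenvector; the integrand is the constant `⟨Φ, Φ⟩` on the compact torus
    haveI : SecondCountableTopology (v.adicCompletion F) := secondCountableTopology_localField _
    haveI : CompactSpace (localPi E c 1 J₁ v) := compactSpace_localPi_one_of_smul_eq c J₁ hc hJ₁ w hw
    have hE : IsField (LocalRing E v) := LocalRing.isField_of_smul_eq c hc w hw
    have hca : (⇑c ∘ ⇑(algebraMap F E)) = ⇑(algebraMap F E) := funext fun x => AlgEquiv.commutes c x
    have hJh : (J.map c)ᵀ = J := by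
      rw [hJ, Matrix.map_map, hca, ← Matrix.transpose_map, hT.eq]
    have hJdet : J.det ≠ 0 := by
      rw [hJ, ← RingHom.mapMatrix_apply, ← RingHom.map_det]
      exact (map_ne_zero_iff _ (algebraMap F E).injective).2 hTd.ne_zero
    obtain ⟨Φ, -, hΦ, -, hne⟩ := Li1992.exists_localFactor_ne_zero_of_nonsplit_of_three_le F E c N δ hcδ hδ d hd T hT hTd J hJ v
      (hE := hE) (hJh := hJh) (hJdet := hJdet) (s := 𝓢.s v) (hs := 𝓢.proj_s v) (hsm := 𝓢.smooth v) (J₁ := J₁) (hJ₁ := hJ₁)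
      (χ := localCharOfCenter F E c J₁ hJ₁ χ₁ v) (hχu := norm_localCharOfCenter F E c J₁ hJ₁ hχ₁u v)
      (hχc := continuous_coe_localCharOfCenter F E c J₁ hJ₁ hχ₁ v) (μX := Measure.pi fun _ : Fin N => μ') (dh := dh) (h3 := h3)
    refine ⟨Φ, ?_, hne⟩
    -- the integrand is constant
    have hconst : ∀ z : localPi E c 1 J₁ v,
        (∫ x, ((𝓢.omegaLoc v (localCenter E c N J J₁ hJ₁ v z) Φ :
              SchwartzBruhat (Fin N → v.adicCompletion F)) : (Fin N → v.adicCompletion F) → ℂ) x *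
            conj (((Φ : SchwartzBruhat (Fin N → v.adicCompletion F)) : (Fin N → v.adicCompletion F) → ℂ) x)
            ∂(Measure.pi fun _ : Fin N => μ')) * conj ((localCharOfCenter F E c J₁ hJ₁ χ₁ v z : ℂˣ) : ℂ) =
          ∫ x, ((Φ : SchwartzBruhat (Fin N → v.adicCompletion F)) : (Fin N → v.adicCompletion F) → ℂ) x *
            conj (((Φ : SchwartzBruhat (Fin N → v.adicCompletion F)) : (Fin N → v.adicCompletion F) → ℂ) x)
            ∂(Measure.pi fun _ : Fin N => μ') := by
      intro z
      have hΦz : 𝓢.omegaLoc v (localCenter E c N J J₁ hJ₁ v z) Φ = ((localCharOfCenter F E c J₁ hJ₁ χ₁ v z : ℂˣ) : ℂ) • Φ := hΦ z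
      have hcoe : ((𝓢.omegaLoc v (localCenter E c N J J₁ hJ₁ v z) Φ : SchwartzBruhat (Fin N → v.adicCompletion F)) :
          (Fin N → v.adicCompletion F) → ℂ) =
          ((localCharOfCenter F E c J₁ hJ₁ χ₁ v z : ℂˣ) : ℂ) • ((Φ : SchwartzBruhat (Fin N → v.adicCompletion F)) :
            (Fin N → v.adicCompletion F) → ℂ) := by
        rw [hΦz, Submodule.coe_smul]
      have hunit : ((localCharOfCenter F E c J₁ hJ₁ χ₁ v z : ℂˣ) : ℂ) * conj ((localCharOfCenter F E c J₁ hJ₁ χ₁ v z : ℂˣ) : ℂ) = 1 := by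
        simp [Complex.mul_conj', norm_localCharOfCenter F E c J₁ hJ₁ hχ₁u v z]
      simp_rw [hcoe, Pi.smul_apply, smul_eq_mul, mul_assoc, integral_const_mul]
      rw [mul_comm, ← mul_assoc, mul_comm (conj _), hunit, one_mul]
    exact (integrable_const _).congr (Filter.Eventually.of_forall fun z => (hconst z).symm)
  · -- split `v`: the ramified test vector
    obtain ⟨Φ, hint, hne⟩ := 𝓢.exists_testVector_localFactor_ne_zero_of_split_localCharOfCenter J₁ hJ₁ hTd hJ₁c v w hw hχ₁ dh μ'
    exact ⟨Φ, hint, hne⟩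

include hTd in
/-- **[Li1992 (27)] — A FACTORIZABLE TEST VECTOR WITH CONVERGENT, FACTORWISE NON-ZERO EULER PRODUCT.**  For a restricted family `𝓢` of local
splittings with `ω_v` `L²(μ'_vᴺ)`-isometric, `dim J = N ≥ 3`, a continuous unitary character `χ₁` of `E¹(𝔸_{F,f})`, local left-invariant measures
`ν^W_v` on `U(J₁)(F_v)` (finite on compacts, charging open sets) with `ν^W_v(U(J₁)(𝒪_v)) = 1` off a finite `S₀`, and any finite `T₀`: there are a
finite `T ⊇ T₀` and a family `Φ = (Φ_v)_v`, `Φ_v = 1_{𝒪_vᴺ}` off `T`, such that the normalised local factors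
`fl_v(g) = (μ'_vᴺ(𝒪_vᴺ)⁻¹ • ⟨ω_v(g·1)Φ_v, Φ_v⟩_{μ'_vᴺ}) · conj χ_{1,v}(g)` are ALL integrable, their `L¹` partial products are bounded by ONE
constant, `Σ_v |∫ fl_v − 1| < ∞`, and `∫ fl_v dν^W_v ≠ 0` for EVERY `v` — the four rows under which the Euler exchange over
`U(J₁)(𝔸_{F,f}) = Πʳ_v U(J₁)(F_v)` and the non-vanishing of `∏'_v ∫ fl_v` hold ([TateThesis1967, Thm 3.3.1]; [Li1992, (27) and §5]).
[cite: Li1992, Thm 2.1 (27) p. 184; §5 Thm 5.4, Cor. 5.5 p. 206] [cite: TateThesis1967, Thm 3.3.1] -/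
theorem exists_family_localFactor_rows (h3 : 3 ≤ N) (hJ₁c : (J₁.map c)ᵀ = J₁)
    {χ₁ : finAdelicOne F E c →* ℂˣ} (hχ₁ : Continuous χ₁) (hχ₁u : ∀ x, ‖((χ₁ x : ℂˣ) : ℂ)‖ = 1)
    [∀ v : HeightOneSpectrum (𝓞 F), MeasurableSpace (v.adicCompletion F)] [∀ v : HeightOneSpectrum (𝓞 F), BorelSpace (v.adicCompletion F)]
    (μ' : ∀ v : HeightOneSpectrum (𝓞 F), Measure (v.adicCompletion F)) [∀ v, (μ' v).IsAddHaarMeasure]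
    (hL2 : ∀ v : HeightOneSpectrum (𝓞 F), (𝓢.omegaLoc v).IsL2Isometric (Measure.pi fun _ : Fin N => μ' v))
    [∀ v : HeightOneSpectrum (𝓞 F), MeasurableSpace (localPi E c 1 J₁ v)] [∀ v : HeightOneSpectrum (𝓞 F), BorelSpace (localPi E c 1 J₁ v)]
    (νW : ∀ v : HeightOneSpectrum (𝓞 F), Measure (localPi E c 1 J₁ v)) [∀ v, (νW v).IsMulLeftInvariant]
    [∀ v, IsFiniteMeasureOnCompacts (νW v)] [∀ v, (νW v).IsOpenPosMeasure]
    (S₀ : Finset (HeightOneSpectrum (𝓞 F))) (hB1 : ∀ v, v ∉ S₀ → νW v (localInt E c 1 J₁ v : Set (localPi E c 1 J₁ v)) = 1)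
    (T₀ : Finset (HeightOneSpectrum (𝓞 F))) :
    ∃ (Tf : Finset (HeightOneSpectrum (𝓞 F))) (Φ : LocalSBFamily F (Fin N)), T₀ ⊆ Tf ∧ S₀ ⊆ Tf ∧
      (∀ v, v ∉ Tf → Φ v = unitVec F (Fin N) v) ∧
      ∀ fl : ∀ v : HeightOneSpectrum (𝓞 F), localPi E c 1 J₁ v → ℂ,
        fl = (fun (v : HeightOneSpectrum (𝓞 F)) (g : localPi E c 1 J₁ v) =>
          (((Measure.pi fun _ : Fin N => μ' v) (integralBox F (Fin N) v)).toReal⁻¹ •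
            ∫ x, ((𝓢.omegaLoc v (localCenter E c N J J₁ hJ₁ v g) (Φ v) :
                SchwartzBruhat (Fin N → v.adicCompletion F)) : (Fin N → v.adicCompletion F) → ℂ) x *
              conj (((Φ v : SchwartzBruhat (Fin N → v.adicCompletion F)) : (Fin N → v.adicCompletion F) → ℂ) x)
              ∂(Measure.pi fun _ : Fin N => μ' v)) *
            conj ((localCharOfCenter F E c J₁ hJ₁ χ₁ v g : ℂˣ) : ℂ)) →
        (∀ v, Integrable (fl v) (νW v)) ∧
        (∃ B : ℝ, ∀ S : Finset (HeightOneSpectrum (𝓞 F)), ∏ v ∈ S, ∫ g, ‖fl v g‖ ∂νW v ≤ B) ∧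
        (Summable fun v => ‖(∫ g, fl v g ∂νW v) - 1‖) ∧
        ∀ v, ∫ g, fl v g ∂νW v ≠ 0 := by
  classical
  haveI : NeZero N := ⟨by omega⟩
  have h2 : 2 ≤ N := by omega
  -- the two exceptional finite sets: the eventual bounds (read at `νW v`, off `S₀`) and the unramified non-vanishing
  have hbd' := ((𝓢.eventually_localFactor_unitVec_normalised_bounds J₁ hJ₁ hTd hJ₁c h2 hχ₁ hχ₁u μ' hL2).and
    S₀.eventually_cofinite_notMem).mono fun v hv => hv.1 (νW v) (hB1 v hv.2)
  have hnz' := (𝓢.eventually_localFactor_unitVec_ne_zero J₁ hJ₁ hTd hJ₁c hχ₁ hχ₁u μ' hL2).mono fun v hv => hv (νW v)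
  have hall := hbd'.and hnz'
  rw [Filter.eventually_cofinite] at hall
  set T₁ : Finset (HeightOneSpectrum (𝓞 F)) := hall.toFinset with hT₁
  set Tf : Finset (HeightOneSpectrum (𝓞 F)) := T₀ ∪ S₀ ∪ T₁ with hTf
  have hT₀ : T₀ ⊆ Tf := fun v hv => by simp only [hTf, Finset.mem_union]; exact Or.inl (Or.inl hv)
  have hS₀ : S₀ ⊆ Tf := fun v hv => by simp only [hTf, Finset.mem_union]; exact Or.inl (Or.inr hv)
  have hoff₁ : ∀ v, v ∉ Tf → v ∉ T₁ := fun v hv h => hv (by simp only [hTf, Finset.mem_union]; exact Or.inr h)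
  -- test vectors everywhere (used on `Tf`), spherical vectors off `Tf`
  choose Φt hΦt using fun v : HeightOneSpectrum (𝓞 F) =>
    𝓢.exists_testVector_integrable_localFactor_ne_zero_of_three_le J₁ hJ₁ hTd h3 hJ₁c v hχ₁ hχ₁u (νW v) (μ' v)
  let Φ : LocalSBFamily F (Fin N) := RestrictedFamily.extend Tf fun v : ↥Tf => Φt v
  have hΦoff : ∀ v, v ∉ Tf → Φ v = unitVec F (Fin N) v := fun v hv => RestrictedFamily.extend_apply_of_notMem Tf _ hv
  have hΦon : ∀ v, v ∈ Tf → Φ v = Φt v := fun v hv => RestrictedFamily.extend_apply_of_mem Tf _ hv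
  refine ⟨Tf, Φ, hT₀, hS₀, hΦoff, fun fl hfl_def => ?_⟩
  -- positivity of the normalising constants
  have hCpos : ∀ v, 0 < ((Measure.pi fun _ : Fin N => μ' v) (integralBox F (Fin N) v)).toReal := fun v => by
    haveI : SecondCountableTopology (v.adicCompletion F) := secondCountableTopology_localField _
    exact ENNReal.toReal_pos ((isOpen_integralBox F (Fin N) v).measure_pos _ ⟨0, zero_mem_integralBox F (Fin N) v⟩).ne'
      (isCompact_integralBox F (Fin N) v).measure_lt_top.ne
  -- `fl v = C_v⁻¹ • (unnormalised integrand with Φ v)`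
  have hflv : ∀ v, fl v = fun g => ((Measure.pi fun _ : Fin N => μ' v) (integralBox F (Fin N) v)).toReal⁻¹ •
      ((∫ x, ((𝓢.omegaLoc v (localCenter E c N J J₁ hJ₁ v g) (Φ v) :
            SchwartzBruhat (Fin N → v.adicCompletion F)) : (Fin N → v.adicCompletion F) → ℂ) x *
          conj (((Φ v : SchwartzBruhat (Fin N → v.adicCompletion F)) : (Fin N → v.adicCompletion F) → ℂ) x)
          ∂(Measure.pi fun _ : Fin N => μ' v)) * conj ((localCharOfCenter F E c J₁ hJ₁ χ₁ v g : ℂˣ) : ℂ)) := by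
    intro v
    rw [hfl_def]
    funext g
    simp only [smul_mul_assoc]
  -- OFF `Tf`: the normalised spherical rows
  have key_off : ∀ v, v ∉ Tf →
      Integrable (fl v) (νW v) ∧
        ‖(∫ g, fl v g ∂νW v) - 1‖ ≤ 12 * (Ideal.absNorm v.asIdeal : ℝ) ^ (-((N : ℝ) / 2)) ∧
        ∫ g, ‖fl v g‖ ∂νW v ≤ 1 + 4 * (Ideal.absNorm v.asIdeal : ℝ) ^ (-((N : ℝ) / 2)) ∧
        ∫ g, fl v g ∂νW v ≠ 0 := by
    intro v hv
    obtain ⟨⟨hint, hI, hA⟩, hne⟩ := not_not.1 fun h => hoff₁ v hv (hall.mem_toFinset.2 h)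
    rw [hfl_def]
    simp only [hΦoff v hv]
    refine ⟨hint, hI, hA, ?_⟩
    simp_rw [smul_mul_assoc]
    rw [integral_smul]
    exact smul_ne_zero (inv_ne_zero (hCpos v).ne') hne
  -- ON `Tf`: the test-vector rows
  have key_on : ∀ v, v ∈ Tf → Integrable (fl v) (νW v) ∧ ∫ g, fl v g ∂νW v ≠ 0 := by
    intro v hv
    obtain ⟨hint, hne⟩ := hΦt v
    rw [hflv v, hΦon v hv]
    refine ⟨hint.smul (((Measure.pi fun _ : Fin N => μ' v) (integralBox F (Fin N) v)).toReal⁻¹), ?_⟩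
    rw [integral_smul]
    exact smul_ne_zero (inv_ne_zero (hCpos v).ne') hne
  have hint_all : ∀ v, Integrable (fl v) (νW v) := fun v => by
    by_cases hv : v ∈ Tf
    · exact (key_on v hv).1
    · exact (key_off v hv).1
  have hsum3 := Li1992.summable_absNorm_rpow_neg_half_of_three_le F h3
  refine ⟨hint_all, ?_, ?_, fun v => ?_⟩
  · -- bounded partial products
    exact Li1992.exists_prod_le_of_eventually_le_one_add (fun v => ∫ g, ‖fl v g‖ ∂νW v)
      (fun v => 4 * (Ideal.absNorm v.asIdeal : ℝ) ^ (-((N : ℝ) / 2))) (fun v => integral_nonneg fun g => norm_nonneg _)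
      (fun v => mul_nonneg (by norm_num) (Real.rpow_nonneg (Nat.cast_nonneg _) _)) (hsum3.mul_left 4)
      (Tf.eventually_cofinite_notMem.mono fun v hv => (key_off v hv).2.2.1)
  · -- `Σ_v ‖I_v − 1‖ < ∞`
    exact Li1992.summable_norm_sub_one_of_eventually_le (fun v => ∫ g, fl v g ∂νW v)
      (fun v => 12 * (Ideal.absNorm v.asIdeal : ℝ) ^ (-((N : ℝ) / 2))) (hsum3.mul_left 12)
      (Tf.eventually_cofinite_notMem.mono fun v hv => (key_off v hv).2.1)
  · -- every factor is non-zero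
    by_cases hv : v ∈ Tf
    · exact (key_on v hv).2
    · exact (key_off v hv).2.2.2

end Literature.NumberTheory.GelbartRogawski1991.UnitaryDualPair.LocalSplitting.FinLocalSplittings

end
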